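/-
Copyright: the b2b-balaban T⁴-continuum CRUX team, row NE7b leaf lineage `t4-ne7b-formalise-leaf-05` (gen 154). Project licence.
-/
import Mathlib.GroupTheory.SemidirectProduct
import Mathlib.Algebra.Group.TypeTags.Basic
import Mathlib.Algebra.BigOperators.Group.Finset.Basic
import Summits.QuantumFields.BalabanUV.T4Continuum.Spine.NE7b.NonAbelianStokesBound

/-!
# THE LINEARISED LATTICE NON-ABELIAN STOKES IDENTITY WITH CURVATURE DEFECT, I — pair holonomy in a semidirect product `N ⋊[φ] G`: the
# `G`-part is the transport, the `N`-part the covariantly transported sum of a 1-form; every word identity of the group-level Stokes calculus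
# holds VERBATIM for pairs, and its `N`-component is the linearised identity: inserting a closed loop adds its TRANSPORTED linearised holonomy —
# EXACTLY at flat background, up to a conjugation defect of size `dist1`(loop holonomy) otherwise; the straight ladder in closed form
# (row NE7b, node U5c; the (h1) slot of print's `γ₀` assembly — `HOME/b2b-balaban-r1/SectE-interface-proof.md` Lemma CS (i), census §8.5
# «NOT kernel-checked: Lemma CS»; part II = `LinearisedLatticeStokesRectangle`: the coordinate rectangle and the additive ∕ `Ad` dictionary)

Cell `pub-balaban`, sub-cell `t4`, spine estimate NE7b (`T4WeightBudget.RelWeightBound`; the cell's OWN estimate — NOT PRINTED in [Bałaban 1983–89],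
NOT PROVED).  Crux-route work under `Spine/NE7b/` by a row leaf; [folklore] lattice gauge algebra on ONE configuration; NOTHING of Bałaban's is named,
asserted or valued; no `T4Continuum/Support` leaf typed; no `def`; zero `sorry`.  Imports: Mathlib (`SemidirectProduct`, `Additive`) + the BUILT
`Spine/NE7b/NonAbelianStokesBound` (`hol_glue`; through it `B7Prop1Explicit`'s words, `hol_ladder_cons`, and `dist1_hol_ladder_seg_le_sum` BY NAME).

WHY (located).  The written repair of [B9] p. 428's `γ₀` claim proves the (h1) letter of `B9SectEKernel.gamma0_assembly` from Lemma CS = «(i) exact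
lattice non-abelian Stokes for the contour `∂S` based at `x`: `Σ_{b∈∂S} Ad(U(γ_{x→b}))A(b) = Σ_{p∈S} Ad(U(lasso_{x→p}))(D_U A)(p)`; (ii) transport
discrepancy `O(ε_F)`; (iii) insert and bound»; `Spine/NE7b/CurlFormEnergyDomination` consumes the resulting letter `(p, q)` DISPLAYED.  The tree's
Stokes files (`NonAbelianStokesBound ∕ Disc ∕ Reading ∕ SU2`, `B13AvgCorrStokesLoop`, `B15ShellGauge193`) are GROUP-level (`dist1` of holonomies);
the LINEARISED identity with transports — and the fact that at CURVED background (i) holds only up to conjugation defects by loop holonomies — was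
typed by no file (tree search 2026-08-24: «lineari», «covariant curl», «SemidirectProduct»: 0 hits outside docstrings).
THE DEVICE.  For `φ : G →* MulAut N` put on every bond a PAIR `W(b) = ⟨A(b), U(b)⟩ ∈ N ⋊[φ] G`.  The pair holonomy `hol W x w` (`B7Prop1Explicit`,
any group) has `G`-part the transport `hol U x w` (`right_hol`) and `N`-part the cocycle `(w₁w₂).left = w₁.left · φ(U(w₁)) w₂.left`
(`left_hol_append`), covariant reversal `A(b⁻¹) = φ(U(b)⁻¹)A(b)⁻¹` built into `stepHol` — for `N = Multiplicative 𝔤`, `φ = Ad`: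
`Σ_{b∈w} Ad(U(w_{<b}))A(b)`, the first variation of the Wilson line; on a plaquette word the covariant lattice curl (`left_hol_plaqWord`).  So every
identity of holonomies valid in ALL groups holds for pairs, its `N`-component being the linearised identity.

WHAT IS PROVED ([folklore]):
* §1 `map_stepHol` ∕ `map_hol` (homs commute with transport), `right_hol` ∕ `right_stepHol`, `left_hol_append` (cocycle), `left_conj`
  (`(ASA⁻¹).left = A.left · φ(A.right) S.left · (φ((ASA⁻¹).right) A.left)⁻¹`), `right_conj`, `aut_aut`, `left_hol_plaqWord` (the covariant curl).
* §2 THE LINEARISED GLUING LEMMA `left_hol_glue` (`disp σ = 0`: `(ασβ).left = L.left · φ(L.right)(αβ).left`, `L` the lasso of `σ` along `α`),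
  `right_lasso`; FLAT EXACTNESS `left_hol_glue_of_flat` ∕ `_comm` (`U(σ) = 1` ⟹ `(ασβ).left = φ(U(α)) σ.left · (αβ).left`, commutative `N`);
  `left_hol_glue_comm` (general case = flat formula × `φ(g)` × the defect `α.left ∕ φ(g) α.left`, `g = U(α)U(σ)U(α)⁻¹`).
* §3 SIZES (commutative `N`, `GaugeGroup G`; displayed letters on `sz : N → ℝ`: subadditive, inversion-invariant, and the CONJUGATION-DEFECT
  letter `sz(φ(g)a · a⁻¹) ≤ c · dist1 g · sz a`): `sz_glue_defect_le` (`≤ c · dist1 U(σ) · (sz α.left + sz (αβ).left)`), `sz_left_hol_append_le`.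
* §4 THE STRAIGHT LADDER (`n` plaquettes `p_i = ∂p_{κμ}(x + ie_κ)`, transports `T_i = U([x, x + ie_κ])`): `hol_seg_succ_front`,
  `hol_ladder_seg_succ ∕ _zero`, `hol_ladder_seg_eq_one_of_flat` (group level), `prod_transport_succ`; **`left_hol_ladder_seg_of_flat`**
  (`(ladder).left = ∏_i φ(T_i) p_i.left` EXACTLY when every `U(∂p_i) = 1`); **`sz_ladder_defect_le`** (`c ≥ 0`, `sz ≥ 0`, `φ` `sz`-isometric:
  `sz((ladder).left ∕ ∏_i φ(T_i) p_i.left) ≤ c · (Σ_i dist1 U(∂p_i)) · Σ_i (sz A(x+ie_κ, κ) + sz p_i.left)` — each defect is a conjugation by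
  a sub-ladder holonomy, priced by `dist1_hol_ladder_seg_le_sum` BY NAME); `ladder_quotient_succ`, `sz_one_eq_zero`, `shift_succ`.

NOT HERE (honest): the rectangle and the `Multiplicative 𝔤` ∕ `Ad` dictionary (part II); `M_k`, (R-M), (R-V), the counting and Jensen ∕ Cauchy–Schwarz
of (5.2), any value of `ε_F`, `c_g` — WHICH configuration, contour and 1-form are Bałaban's ((A3) ∕ (A1c), NC-NE7b-α UNRULED).  BY-NAME EFFECT ON THE
WALL: NONE ((ℓ1)'s (h1) letter keeps its displayed `(p, q)`).  NE7b NOT PRINTED ∕ NOT PROVED; spine PROVED 0∕9; rung (B)+1 on a FINITE torus — NOT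
infinite volume, NOT the mass gap, NOT Clay.  HONEST DEPENDENCY: continuum YM on T⁴ ⇐ BetaPertH ∧ nine spine estimates (0/9 proved); BetaPertH ⇐
(D1) ∧ (D4) ∧ CAP+tail; G-an2-4 gates asym, D1 and NE2/3/4.
-/

set_option autoImplicit false

open scoped BigOperators

namespace Summit.QuantumFields.BalabanUV.T4Continuum.NE7b.LinearisedLatticeStokes

open Literature.MathematicalPhysics.QuantumFieldTheory.Balaban1983to89 (GaugeGroup dist1)
open Literature.MathematicalPhysics.QuantumFieldTheory.Balaban1983to89.B7Prop1Explicit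
  (Site Letter e disp stepHol stepHol_true stepHol_false hol hol_nil hol_cons hol_append seg seg_natCast seg_zero plaqWord
   ladder hol_ladder hol_ladder_cons lplaqWord_true hol_lplaqWord)
open NonAbelianStokesBound (hol_glue dist1_hol_ladder_seg_le_sum)

variable {d : ℕ}

/-! ## §1 Pair holonomy: homs commute with transport; the `G`-part is the transport; the `N`-part is a cocycle -/

section PairHolonomy

variable {G H : Type*} [Group G] [Group H]

/-- A group homomorphism commutes with the one-letter transport `stepHol`. [folklore] -/
theorem map_stepHol (f : G →* H) (V : Site d → Fin d → G) (x : Site d) (l : Letter d) :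
    f (stepHol V x l) = stepHol (fun y k => f (V y k)) x l := by
  obtain ⟨μ, b⟩ := l
  cases b
  · rw [stepHol_false, stepHol_false, map_inv]
  · rw [stepHol_true, stepHol_true]

/-- A group homomorphism commutes with parallel transport along any lattice word. [folklore] -/
theorem map_hol (f : G →* H) (V : Site d → Fin d → G) :
    ∀ (x : Site d) (w : List (Letter d)), f (hol V x w) = hol (fun y k => f (V y k)) x w
  | x, [] => by rw [hol_nil, hol_nil, map_one]
  | x, l :: w => by rw [hol_cons, hol_cons, map_mul, map_stepHol, map_hol f V (x + l.vec) w]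

variable {N : Type*} [Group N] {φ : G →* MulAut N}

/-- Automorphisms compose along `φ`: `φ g₁ (φ g₂ n) = φ (g₁g₂) n`. [folklore] -/
theorem aut_aut (g₁ g₂ : G) (n : N) : φ g₁ (φ g₂ n) = φ (g₁ * g₂) n := by
  rw [map_mul, MulAut.mul_apply]

/-- **THE `G`-PART OF A PAIR HOLONOMY IS THE TRANSPORT.**  For a pair configuration `W = ⟨A, U⟩`, `(hol W x w).right = hol U x w`. [folklore] -/
theorem right_hol (W : Site d → Fin d → N ⋊[φ] G) (U : Site d → Fin d → G) (hU : ∀ y k, (W y k).right = U y k)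
    (x : Site d) (w : List (Letter d)) : (hol W x w).right = hol U x w := by
  have h := map_hol (SemidirectProduct.rightHom (N := N) (G := G) (φ := φ)) W x w
  have e1 : (fun y k => SemidirectProduct.rightHom (W y k)) = U :=
    funext fun y => funext fun k => (hU y k)
  rw [e1] at h
  exact h

/-- The `G`-part of a one-letter pair transport. [folklore] -/
theorem right_stepHol (W : Site d → Fin d → N ⋊[φ] G) (U : Site d → Fin d → G) (hU : ∀ y k, (W y k).right = U y k)
    (x : Site d) (l : Letter d) : (stepHol W x l).right = stepHol U x l := by
  have h := map_stepHol (SemidirectProduct.rightHom (N := N) (G := G) (φ := φ)) W x l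
  have e1 : (fun y k => SemidirectProduct.rightHom (W y k)) = U :=
    funext fun y => funext fun k => (hU y k)
  rw [e1] at h
  exact h

/-- **THE `N`-PART IS A COCYCLE** (the covariantly transported sum): `(w₁w₂).left = w₁.left · φ(U(w₁)) (w₂).left`. [folklore] -/
theorem left_hol_append (W : Site d → Fin d → N ⋊[φ] G) (x : Site d) (w₁ w₂ : List (Letter d)) :
    (hol W x (w₁ ++ w₂)).left = (hol W x w₁).left * φ (hol W x w₁).right (hol W (x + disp w₁) w₂).left := by
  rw [hol_append, SemidirectProduct.mul_left]

/-- The `N`-part of a conjugate (a lasso): `(ASA⁻¹).left = A.left · φ(A.right) S.left · (φ((ASA⁻¹).right) A.left)⁻¹`. [folklore] -/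
theorem left_conj (A S : N ⋊[φ] G) :
    (A * S * A⁻¹).left = A.left * φ A.right S.left * (φ (A * S * A⁻¹).right A.left)⁻¹ := by
  simp only [SemidirectProduct.mul_left, SemidirectProduct.mul_right, SemidirectProduct.inv_left,
    SemidirectProduct.inv_right]
  rw [aut_aut, map_inv (φ (A.right * S.right * A.right⁻¹))]

/-- The `G`-part of a conjugate. [folklore] -/
theorem right_conj (A S : N ⋊[φ] G) : (A * S * A⁻¹).right = A.right * S.right * A.right⁻¹ := by
  simp only [SemidirectProduct.mul_right, SemidirectProduct.inv_right]

/-- **ON A PLAQUETTE WORD THE `N`-PART IS THE COVARIANT LATTICE CURL**: with `a₁ = A(x,κ)`, `a₂ = A(x+e_κ,μ)`, `a₃ = A(x+e_μ,κ)`, `a₄ = A(x,μ)`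
and the partial transports `u₁ = U(x,κ)`, `u₁u₂u₃⁻¹`, `U(∂p)` along `∂p_{κμ}(x)`:
`(∂p).left = a₁ · φ(u₁) a₂ · (φ(u₁u₂u₃⁻¹) a₃)⁻¹ · (φ(U(∂p)) a₄)⁻¹` — for `φ = Ad` additively `A₁ + Ad(u₁)A₂ − Ad(u₁u₂u₃⁻¹)A₃ − Ad(U(∂p))A₄`. [folklore] -/
theorem left_hol_plaqWord (W : Site d → Fin d → N ⋊[φ] G) (U : Site d → Fin d → G) (hU : ∀ y k, (W y k).right = U y k)
    (x : Site d) (κ μ : Fin d) :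
    (hol W x (plaqWord κ μ)).left =
      (W x κ).left * φ (U x κ) (W (x + e κ) μ).left *
        (φ (U x κ * U (x + e κ) μ * (U (x + e μ) κ)⁻¹) (W (x + e μ) κ).left)⁻¹ *
        (φ (U x κ * U (x + e κ) μ * (U (x + e μ) κ)⁻¹ * (U x μ)⁻¹) (W x μ).left)⁻¹ := by
  rw [← lplaqWord_true, hol_lplaqWord, stepHol_true, stepHol_true, Letter.vec_true]
  simp only [SemidirectProduct.mul_left, SemidirectProduct.mul_right, SemidirectProduct.inv_left,
    SemidirectProduct.inv_right, hU]
  rw [aut_aut, aut_aut, map_inv (φ (U x κ * U (x + e κ) μ * (U (x + e μ) κ)⁻¹)) (W (x + e μ) κ).left,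
    map_inv (φ (U x κ * U (x + e κ) μ * (U (x + e μ) κ)⁻¹ * (U x μ)⁻¹)) (W x μ).left]

end PairHolonomy

/-! ## §2 The linearised gluing lemma; flat loops telescope exactly -/

section Glue

variable {G N : Type*} [Group G] [Group N] {φ : G →* MulAut N}
variable (W : Site d → Fin d → N ⋊[φ] G) (U : Site d → Fin d → G)

/-- **THE LINEARISED GLUING LEMMA.**  Inserting a closed loop `σ` (`disp σ = 0`) after `α`: `(ασβ).left = L.left · φ(L.right) (αβ).left`,
where `L = (α)(σ)(α)⁻¹` is the lasso of `σ` along `α` (pair level; `NonAbelianStokesBound.hol_glue` read in `N`). [folklore] -/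
theorem left_hol_glue (x : Site d) (α σ β : List (Letter d)) (hσ : disp σ = 0) :
    (hol W x (α ++ σ ++ β)).left =
      (hol W x α * hol W (x + disp α) σ * (hol W x α)⁻¹).left *
        φ (hol W x α * hol W (x + disp α) σ * (hol W x α)⁻¹).right (hol W x (α ++ β)).left := by
  rw [hol_glue W x α σ β hσ, SemidirectProduct.mul_left]

/-- The transport of the lasso: `L.right = U(α) U(σ) U(α)⁻¹`. [folklore] -/
theorem right_lasso (hU : ∀ y k, (W y k).right = U y k) (x : Site d) (α σ : List (Letter d)) :
    (hol W x α * hol W (x + disp α) σ * (hol W x α)⁻¹).right = hol U x α * hol U (x + disp α) σ * (hol U x α)⁻¹ := by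
  rw [right_conj, right_hol W U hU, right_hol W U hU]

/-- **FLAT EXACTNESS.**  If the inserted loop has trivial transport, `U(σ) = 1`, then
`(ασβ).left = α.left · φ(U(α)) σ.left · α.left⁻¹ · (αβ).left` — no defect. [folklore] -/
theorem left_hol_glue_of_flat (hU : ∀ y k, (W y k).right = U y k) (x : Site d) (α σ β : List (Letter d)) (hσ : disp σ = 0)
    (hflat : hol U (x + disp α) σ = 1) :
    (hol W x (α ++ σ ++ β)).left =
      (hol W x α).left * φ (hol U x α) (hol W (x + disp α) σ).left * (hol W x α).left⁻¹ * (hol W x (α ++ β)).left := by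
  rw [left_hol_glue W x α σ β hσ, left_conj, right_lasso W U hU, right_hol W U hU, hflat, mul_one, mul_inv_cancel,
    map_one, MulAut.one_apply, MulAut.one_apply]

end Glue

section GlueComm

variable {G N : Type*} [Group G] [CommGroup N] {φ : G →* MulAut N}
variable (W : Site d → Fin d → N ⋊[φ] G) (U : Site d → Fin d → G)

/-- **FLAT LOOPS TELESCOPE** (commutative `N`, e.g. `Multiplicative 𝔤`): `U(σ) = 1` ⟹ `(ασβ).left = φ(U(α)) σ.left · (αβ).left` — inserting a
flat closed loop adds EXACTLY its transported linearised holonomy. [folklore] -/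
theorem left_hol_glue_of_flat_comm (hU : ∀ y k, (W y k).right = U y k) (x : Site d) (α σ β : List (Letter d))
    (hσ : disp σ = 0) (hflat : hol U (x + disp α) σ = 1) :
    (hol W x (α ++ σ ++ β)).left = φ (hol U x α) (hol W (x + disp α) σ).left * (hol W x (α ++ β)).left := by
  rw [left_hol_glue_of_flat W U hU x α σ β hσ hflat, mul_inv_cancel_comm]

/-- The general case REARRANGED against the flat formula: `(ασβ).left = φ(U(α)) σ.left · φ(g)(αβ).left · (α.left ∕ φ(g) α.left)`,
`g = U(α)U(σ)U(α)⁻¹` — the last factor is the CURVATURE DEFECT (trivial iff `φ(g)` fixes `α.left`). [folklore] -/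
theorem left_hol_glue_comm (hU : ∀ y k, (W y k).right = U y k) (x : Site d) (α σ β : List (Letter d)) (hσ : disp σ = 0) :
    (hol W x (α ++ σ ++ β)).left =
      φ (hol U x α) (hol W (x + disp α) σ).left *
        φ (hol U x α * hol U (x + disp α) σ * (hol U x α)⁻¹) (hol W x (α ++ β)).left *
        ((hol W x α).left * (φ (hol U x α * hol U (x + disp α) σ * (hol U x α)⁻¹) (hol W x α).left)⁻¹) := by
  rw [left_hol_glue W x α σ β hσ, left_conj, right_lasso W U hU, right_hol W U hU]
  apply Additive.ofMul.injective
  simp only [ofMul_mul, ofMul_inv]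
  abel

end GlueComm

/-! ## §3 Sizes: the displayed size letters and the defect of one gluing step -/

section Sizes

variable {G N : Type*} [GaugeGroup G] [CommGroup N] {φ : G →* MulAut N}
variable (W : Site d → Fin d → N ⋊[φ] G) (U : Site d → Fin d → G)

/-- **THE DEFECT OF ONE GLUING STEP.**  Size letters on `sz : N → ℝ` (subadditive, inversion-invariant) + the CONJUGATION-DEFECT letter
`sz (φ g a · a⁻¹) ≤ c · dist1 g · sz a`: the `N`-part of `ασβ` differs from the flat formula `φ(U(α)) σ.left · (αβ).left` by an element of size
`≤ c · dist1 U(σ) · (sz α.left + sz (αβ).left)` (the lasso costs what the loop costs: `dist1` is conjugation invariant). [folklore] -/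
theorem sz_glue_defect_le (hU : ∀ y k, (W y k).right = U y k) (sz : N → ℝ) {c : ℝ}
    (hmul : ∀ a b, sz (a * b) ≤ sz a + sz b) (hinv : ∀ a, sz a⁻¹ = sz a)
    (hdef : ∀ (g : G) (a : N), sz (φ g a * a⁻¹) ≤ c * dist1 g * sz a)
    (x : Site d) (α σ β : List (Letter d)) (hσ : disp σ = 0) :
    sz ((hol W x (α ++ σ ++ β)).left *
        (φ (hol U x α) (hol W (x + disp α) σ).left * (hol W x (α ++ β)).left)⁻¹)
      ≤ c * dist1 (hol U (x + disp α) σ) * (sz (hol W x α).left + sz (hol W x (α ++ β)).left) := by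
  rw [left_hol_glue_comm W U hU x α σ β hσ]
  set g := hol U x α * hol U (x + disp α) σ * (hol U x α)⁻¹ with hg
  set a := (hol W x α).left
  set b := (hol W x (α ++ β)).left
  set s := (hol W (x + disp α) σ).left
  have e1 : φ (hol U x α) s * φ g b * (a * (φ g a)⁻¹) * (φ (hol U x α) s * b)⁻¹ = (φ g a * a⁻¹)⁻¹ * (φ g b * b⁻¹) := by
    apply Additive.ofMul.injective
    simp only [ofMul_mul, ofMul_inv]
    abel
  have hdist : dist1 g = dist1 (hol U (x + disp α) σ) := by rw [hg, GaugeGroup.dist1_conj]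
  rw [e1]
  calc sz ((φ g a * a⁻¹)⁻¹ * (φ g b * b⁻¹)) ≤ sz (φ g a * a⁻¹)⁻¹ + sz (φ g b * b⁻¹) := hmul _ _
    _ = sz (φ g a * a⁻¹) + sz (φ g b * b⁻¹) := by rw [hinv]
    _ ≤ c * dist1 g * sz a + c * dist1 g * sz b := add_le_add (hdef g a) (hdef g b)
    _ = c * dist1 (hol U (x + disp α) σ) * (sz a + sz b) := by rw [hdist]; ring

/-- Sizes of `N`-parts ADD along words when `φ` is `sz`-isometric: `sz (w₁w₂).left ≤ sz w₁.left + sz w₂.left`. [folklore] -/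
theorem sz_left_hol_append_le (sz : N → ℝ) (hmul : ∀ a b, sz (a * b) ≤ sz a + sz b) (hiso : ∀ (g : G) (a : N), sz (φ g a) = sz a)
    (x : Site d) (w₁ w₂ : List (Letter d)) :
    sz (hol W x (w₁ ++ w₂)).left ≤ sz (hol W x w₁).left + sz (hol W (x + disp w₁) w₂).left := by
  rw [left_hol_append]
  exact (hmul _ _).trans (by rw [hiso])

end Sizes

/-! ## §4 The straight ladder: `n` plaquettes `∂p_{κμ}(x + i e_κ)` along `[x, x + n e_κ]`, closed through `+e_μ` -/

section Ladder

variable {G : Type*} [Group G]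

/-- `V([x, x + (i+1)e_κ]) = V(x, x+e_κ) · V([x+e_κ, x+e_κ+ie_κ])` (one more step at the FRONT of a straight segment). [folklore] -/
theorem hol_seg_succ_front (V : Site d → Fin d → G) (x : Site d) (κ : Fin d) (i : ℕ) :
    hol V x (seg κ ((i + 1 : ℕ) : ℤ)) = V x κ * hol V (x + e κ) (seg κ (i : ℤ)) := by
  rw [seg_natCast, List.replicate_succ, hol_cons, stepHol_true, Letter.vec_true, ← seg_natCast]

/-- The straight-ladder recursion (`hol_ladder_cons` at `+e_κ`): `V(ladder_{n+1}(x)) = (g·V(ladder_n(x+e_κ))·g⁻¹)·V(∂p_{κμ}(x))`, `g = V(x,x+e_κ)`. -/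
theorem hol_ladder_seg_succ (V : Site d → Fin d → G) (x : Site d) (κ μ : Fin d) (n : ℕ) :
    hol V x (ladder (seg κ ((n + 1 : ℕ) : ℤ)) μ) =
      V x κ * hol V (x + e κ) (ladder (seg κ (n : ℤ)) μ) * (V x κ)⁻¹ * hol V x (plaqWord κ μ) := by
  rw [seg_natCast, List.replicate_succ, ← seg_natCast, hol_ladder_cons, lplaqWord_true, Letter.vec_true, stepHol_true]

/-- The degenerate ladder over the empty segment has trivial holonomy. [folklore] -/
theorem hol_ladder_seg_zero (V : Site d → Fin d → G) (x : Site d) (κ μ : Fin d) :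
    hol V x (ladder (seg κ ((0 : ℕ) : ℤ)) μ) = 1 := by rw [seg_natCast, List.replicate_zero, hol_ladder]; simp

/-- The shift `x + e_κ + i e_κ = x + (i+1) e_κ`. [folklore] -/
theorem shift_succ (x : Site d) (κ : Fin d) (i : ℕ) : x + e κ + (i : ℤ) • e κ = x + ((i + 1 : ℕ) : ℤ) • e κ := by rw [Nat.cast_succ, add_smul, one_smul]; abel

/-- **GROUP-LEVEL FLATNESS OF THE LADDER**: if every plaquette `∂p_{κμ}(x + ie_κ)`, `i < n`, has trivial holonomy, so has the ladder. [folklore] -/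
theorem hol_ladder_seg_eq_one_of_flat (V : Site d → Fin d → G) (κ μ : Fin d) :
    ∀ (n : ℕ) (x : Site d), (∀ i : ℕ, i < n → hol V (x + (i : ℤ) • e κ) (plaqWord κ μ) = 1) →
      hol V x (ladder (seg κ (n : ℤ)) μ) = 1
  | 0, x, _ => hol_ladder_seg_zero V x κ μ
  | n + 1, x, h => by
    have h0 : hol V x (plaqWord κ μ) = 1 := by simpa using h 0 (Nat.succ_pos n)
    have ih := hol_ladder_seg_eq_one_of_flat V κ μ n (x + e κ) fun i hi => by
      rw [shift_succ]; exact h (i + 1) (Nat.succ_lt_succ hi)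
    rw [hol_ladder_seg_succ, ih, h0, mul_one, mul_one, mul_inv_cancel]

variable {N : Type*} [CommGroup N] {φ : G →* MulAut N}
variable (W : Site d → Fin d → N ⋊[φ] G) (U : Site d → Fin d → G)

/-- **INDEX SHIFT OF THE FLAT FORMULA**: `∏_{i<n+1} φ(T_i(x)) p_i(x).left = φ(U(x,x+e_κ)) (∏_{i<n} φ(T_i(x+e_κ)) p_i(x+e_κ).left) · p_0(x).left`. -/
theorem prod_transport_succ (x : Site d) (κ μ : Fin d) (n : ℕ) :
    ∏ i ∈ Finset.range (n + 1), φ (hol U x (seg κ (i : ℤ))) (hol W (x + (i : ℤ) • e κ) (plaqWord κ μ)).left =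
      φ (U x κ) (∏ i ∈ Finset.range n,
          φ (hol U (x + e κ) (seg κ (i : ℤ))) (hol W (x + e κ + (i : ℤ) • e κ) (plaqWord κ μ)).left) *
        (hol W x (plaqWord κ μ)).left := by
  rw [Finset.prod_range_succ', map_prod]
  congr 1
  · refine Finset.prod_congr rfl fun i _ => ?_
    rw [aut_aut, ← hol_seg_succ_front, shift_succ]
  · rw [Nat.cast_zero, zero_smul, add_zero, seg_zero, hol_nil, map_one, MulAut.one_apply]

/-- **THE LINEARISED STOKES IDENTITY FOR A FLAT LADDER.**  If every plaquette transport `U(∂p_{κμ}(x + ie_κ))`, `i < n`, is trivial, the `N`-part of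
the ladder's pair holonomy is EXACTLY `∏_{i<n} φ(U([x, x+ie_κ])) (∂p_{κμ}(x+ie_κ)).left` (transported linearised plaquette holonomies). [folklore] -/
theorem left_hol_ladder_seg_of_flat (hU : ∀ y k, (W y k).right = U y k) (κ μ : Fin d) :
    ∀ (n : ℕ) (x : Site d), (∀ i : ℕ, i < n → hol U (x + (i : ℤ) • e κ) (plaqWord κ μ) = 1) →
      (hol W x (ladder (seg κ (n : ℤ)) μ)).left =
        ∏ i ∈ Finset.range n, φ (hol U x (seg κ (i : ℤ))) (hol W (x + (i : ℤ) • e κ) (plaqWord κ μ)).left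
  | 0, x, _ => by rw [hol_ladder_seg_zero, Finset.prod_range_zero, SemidirectProduct.one_left]
  | n + 1, x, h => by
    have h' : ∀ i : ℕ, i < n → hol U (x + e κ + (i : ℤ) • e κ) (plaqWord κ μ) = 1 := fun i hi => by
      rw [shift_succ]; exact h (i + 1) (Nat.succ_lt_succ hi)
    have ih := left_hol_ladder_seg_of_flat hU κ μ n (x + e κ) h'
    have hH : hol U (x + e κ) (ladder (seg κ (n : ℤ)) μ) = 1 := hol_ladder_seg_eq_one_of_flat U κ μ n (x + e κ) h'
    have hg : (W x κ).right = U x κ := hU x κ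
    rw [prod_transport_succ, ← ih, hol_ladder_seg_succ, SemidirectProduct.mul_left, left_conj, right_conj, hg,
      right_hol W U hU, hH, mul_one, mul_inv_cancel, map_one, MulAut.one_apply, MulAut.one_apply, mul_inv_cancel_comm]

end Ladder

section LadderSizes

variable {G N : Type*} [GaugeGroup G] [CommGroup N] {φ : G →* MulAut N}
variable (W : Site d → Fin d → N ⋊[φ] G) (U : Site d → Fin d → G)

/-- The algebra of one ladder step against the flat formula (commutative `N`). [folklore] -/
theorem ladder_quotient_succ (gl L F P : N) (g k : G) :
    gl * φ g L * (φ k gl)⁻¹ * φ k P * (φ g F * P)⁻¹ = φ g (L * F⁻¹) * ((φ k gl * gl⁻¹)⁻¹ * (φ k P * P⁻¹)) := by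
  rw [map_mul, map_inv]; apply Additive.ofMul.injective; simp only [ofMul_mul, ofMul_inv]; abel

/-- The size of `1` vanishes under the letters (from the defect letter at `g = 1` and nonnegativity). [folklore] -/
theorem sz_one_eq_zero (sz : N → ℝ) {c : ℝ} (h0 : ∀ a, 0 ≤ sz a)
    (hdef : ∀ (g : G) (a : N), sz (φ g a * a⁻¹) ≤ c * dist1 g * sz a) : sz 1 = 0 := by
  have h := hdef 1 1
  rw [map_one, inv_one, mul_one, GaugeGroup.dist1_one, mul_zero, zero_mul] at h
  exact le_antisymm h (h0 1)

/-- **THE LINEARISED STOKES ESTIMATE FOR A STRAIGHT LADDER WITH CURVATURE.**  Under the size letters (`sz` subadditive, inversion-invariant,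
nonnegative, `φ`-isometric; conjugation defect `sz(φ(g)a · a⁻¹) ≤ c · dist1 g · sz a`, `c ≥ 0`), the `N`-part of the ladder's pair holonomy
differs from the flat formula `∏_{i<n} φ(U([x, x+ie_κ])) (∂p_i).left` by an element of size
`≤ c · (Σ_{i<n} dist1 U(∂p_i)) · Σ_{i<n} (sz A(x+ie_κ, κ) + sz (∂p_i).left)` — every defect is a conjugation by a sub-ladder holonomy, whose
`dist1` is at most the plaquette sum by the group-level Stokes bound `NonAbelianStokesBound.dist1_hol_ladder_seg_le_sum`. [folklore] -/
theorem sz_ladder_defect_le (hU : ∀ y k, (W y k).right = U y k) (sz : N → ℝ) {c : ℝ} (hc : 0 ≤ c) (h0 : ∀ a, 0 ≤ sz a)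
    (hmul : ∀ a b, sz (a * b) ≤ sz a + sz b) (hinv : ∀ a, sz a⁻¹ = sz a) (hiso : ∀ (g : G) (a : N), sz (φ g a) = sz a)
    (hdef : ∀ (g : G) (a : N), sz (φ g a * a⁻¹) ≤ c * dist1 g * sz a) (κ μ : Fin d) :
    ∀ (n : ℕ) (x : Site d),
      sz ((hol W x (ladder (seg κ (n : ℤ)) μ)).left *
          (∏ i ∈ Finset.range n, φ (hol U x (seg κ (i : ℤ))) (hol W (x + (i : ℤ) • e κ) (plaqWord κ μ)).left)⁻¹)
        ≤ c * (∑ i ∈ Finset.range n, dist1 (hol U (x + (i : ℤ) • e κ) (plaqWord κ μ))) *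
            ∑ i ∈ Finset.range n, (sz (W (x + (i : ℤ) • e κ) κ).left + sz (hol W (x + (i : ℤ) • e κ) (plaqWord κ μ)).left)
  | 0, x => by
    rw [hol_ladder_seg_zero, Finset.prod_range_zero, Finset.sum_range_zero, Finset.sum_range_zero,
      SemidirectProduct.one_left, inv_one, mul_one, sz_one_eq_zero sz h0 hdef]
    simp
  | n + 1, x => by
    have ih := sz_ladder_defect_le hU sz hc h0 hmul hinv hiso hdef κ μ n (x + e κ)
    -- the curvature letters of this step
    set H := hol U (x + e κ) (ladder (seg κ (n : ℤ)) μ) with hH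
    set S' := ∑ i ∈ Finset.range n, dist1 (hol U (x + e κ + (i : ℤ) • e κ) (plaqWord κ μ)) with hS'
    set S := ∑ i ∈ Finset.range (n + 1), dist1 (hol U (x + (i : ℤ) • e κ) (plaqWord κ μ)) with hS
    set B' := ∑ i ∈ Finset.range n,
      (sz (W (x + e κ + (i : ℤ) • e κ) κ).left + sz (hol W (x + e κ + (i : ℤ) • e κ) (plaqWord κ μ)).left) with hB'
    have hSsucc : S = S' + dist1 (hol U x (plaqWord κ μ)) := by
      rw [hS, Finset.sum_range_succ', Nat.cast_zero, zero_smul, add_zero]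
      exact congrArg (· + _) (Finset.sum_congr rfl fun i _ => by rw [← shift_succ])
    have hBsucc : ∑ i ∈ Finset.range (n + 1),
        (sz (W (x + (i : ℤ) • e κ) κ).left + sz (hol W (x + (i : ℤ) • e κ) (plaqWord κ μ)).left)
          = B' + (sz (W x κ).left + sz (hol W x (plaqWord κ μ)).left) := by
      rw [hB', Finset.sum_range_succ', Nat.cast_zero, zero_smul, add_zero]
      exact congrArg (· + _) (Finset.sum_congr rfl fun i _ => by rw [← shift_succ])
    have hS'0 : 0 ≤ S' := Finset.sum_nonneg fun i _ => GaugeGroup.dist1_nonneg _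
    have hB'0 : 0 ≤ B' := Finset.sum_nonneg fun i _ => add_nonneg (h0 _) (h0 _)
    have hS'S : S' ≤ S := by rw [hSsucc]; exact le_add_of_nonneg_right (GaugeGroup.dist1_nonneg _)
    have hk : dist1 (U x κ * H * (U x κ)⁻¹) ≤ S :=
      (le_of_eq (GaugeGroup.dist1_conj _ _)).trans ((dist1_hol_ladder_seg_le_sum U κ μ n (x + e κ)).trans hS'S)
    have hk0 : 0 ≤ dist1 (U x κ * H * (U x κ)⁻¹) := GaugeGroup.dist1_nonneg _
    rw [hol_ladder_seg_succ, SemidirectProduct.mul_left, left_conj, right_conj, hU x κ, right_hol W U hU, ← hH,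
      prod_transport_succ, ladder_quotient_succ, hBsucc]
    set k := U x κ * H * (U x κ)⁻¹
    set gl := (W x κ).left
    set P := (hol W x (plaqWord κ μ)).left
    calc sz (φ (U x κ) ((hol W (x + e κ) (ladder (seg κ (n : ℤ)) μ)).left *
              (∏ i ∈ Finset.range n, φ (hol U (x + e κ) (seg κ (i : ℤ)))
                (hol W (x + e κ + (i : ℤ) • e κ) (plaqWord κ μ)).left)⁻¹) *
            ((φ k gl * gl⁻¹)⁻¹ * (φ k P * P⁻¹)))
        ≤ sz (φ (U x κ) ((hol W (x + e κ) (ladder (seg κ (n : ℤ)) μ)).left *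
              (∏ i ∈ Finset.range n, φ (hol U (x + e κ) (seg κ (i : ℤ)))
                (hol W (x + e κ + (i : ℤ) • e κ) (plaqWord κ μ)).left)⁻¹)) +
            (sz (φ k gl * gl⁻¹)⁻¹ + sz (φ k P * P⁻¹)) := (hmul _ _).trans (add_le_add le_rfl (hmul _ _))
      _ ≤ c * S' * B' + (c * dist1 k * sz gl + c * dist1 k * sz P) := by
          rw [hiso, hinv]
          exact add_le_add ih (add_le_add (hdef k gl) (hdef k P))
      _ ≤ c * S * B' + (c * S * sz gl + c * S * sz P) := by
          have h1 : c * S' * B' ≤ c * S * B' :=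
            mul_le_mul_of_nonneg_right (mul_le_mul_of_nonneg_left hS'S hc) hB'0
          have h2 : c * dist1 k * sz gl ≤ c * S * sz gl :=
            mul_le_mul_of_nonneg_right (mul_le_mul_of_nonneg_left hk hc) (h0 _)
          have h3 : c * dist1 k * sz P ≤ c * S * sz P :=
            mul_le_mul_of_nonneg_right (mul_le_mul_of_nonneg_left hk hc) (h0 _)
          linarith
      _ = c * S * (B' + (sz gl + sz P)) := by ring

end LadderSizes

end Summit.QuantumFields.BalabanUV.T4Continuum.NE7b.LinearisedLatticeStokes
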